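import Summits.QuantumFields.BalabanUV.T4Continuum.Support.B13TermCoreFamily
import Summits.QuantumFields.BalabanUV.T4Continuum.Support.B13TermRep
import Summits.QuantumFields.BalabanUV.T4Continuum.Support.OutputRateOpGaussianParam

/-!
# B13TermCoreMass — row O1-d2-ii «act instance» of the NE5 crux O1, part 8: THE PER-DOMAIN MASS OF A TERM CORE IS AT MOST THE B13
# COMBINATORIAL MAJORANT OF PER-FACTOR MASSES — the `hmass` binder of the R21 END
# (`OutputRateTermwiseLocStructural.ne5_at_of_stepModel_termwiseLoc_gaussianParamBi_mass_scale_nat`) for the term cores of part 7, reduced to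
# `B13TermRep.actMajorant 𝒯 inc A k X i = 𝟙[Rel]·‖coeff i‖·Π_m A (poly i m) (lab i m)` with the FACTOR mass letter
# `A Z j = λ_{Zj}(univ)·wB_{Zj}·N₀f(Z,j)·e^{N₁,Zj·H + bf(Z,j)}·(2π∕m⋆)^{dim V_{Zj}∕2}` — the currency the O1-d2 (iii) Ursell engine sums
# (cell `pub-balaban`, T⁴ fan-out, `HOME/t4/b2b-balaban-t4-ne5-p1/O1-CLAIM-TABLE-NE5-P1.md` row O1-d2-ii; design v0.6 R18∕R21)

Unit `b2b-balaban-t4-ne5-formalise-leaf-08` (NE5 formalisation swarm, leaf prover 08, gen 3).  Summits-side NEW WORK under the LEAN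
PLACEMENT RULE (cell modelling + bookkeeping; nothing of the manuscripts under audit is asserted; 0 cite tags).  HONEST FRAMING: rung
(B)+1 of the FINITE-VOLUME T⁴ continuum programme — NOT infinite volume, NOT a mass gap, NOT the Clay problem, NOT a proof of NE5
(`T4OutputRate.NE5` is NOT PRINTED and NOT PROVED; spine 0/9, unchanged).  HONEST DEPENDENCY (cell line, verbatim): continuum YM on T⁴ ⇐
BetaPertH ∧ nine spine estimates (0/9 proved); BetaPertH ⇐ (D1) ∧ (D4) ∧ CAP+tail; G-an2-4 gates asym, D1 and NE2/3/4.

WHAT THIS MODULE IS.  The R21 END takes, besides `hBi : TermGaussianParamBi T …` (part 7 for the B13 term family with core activities), the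
PER-DOMAIN mass budget `hmass : paramMass α lam m b w₀ N₀ (F·e^{N₁‖h‖}) k i h X ≤ a k i X·e^{−κ d(X)}` with
`paramMass = λ(univ)·w₀·N₀·F e^{N₁‖h‖}·e^{b}·(π∕(m∕2))^{dim α∕2}` (`OutputRateOpGaussianParam.paramMass`).  For the term cores of part 7 the data are products∕sums
of the factors' (`Measure.pi`, `𝟙[Rel]‖coeff‖Π wB`, `Π N₀f`, `Σ N₁`, `Σ bf`, `min mf`, `PiLp 2`), so:
* §1 `lam_termCore_real_univ` (`= Π_m λ_m(univ)`, `Measure.pi_univ`), `finrank_fluct_termCore` (`dim (PiLp 2 V) = Σ_m dim V_m`).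
* §2 `factorMass 𝔠 N₀f bf m⋆ H Z j` — the FACTOR mass letter above (a nonnegative real per factor, `factorMass_nonneg`).
* §3 **`paramMass_termCore_le_actMajorant`**: for a uniform margin floor `0 < m⋆ ≤ mf Z j`, nonnegative letters `0 ≤ wB`, `0 ≤ N₀f`, and
  `‖h‖ ≤ H`, `paramMass … k i h X ≤ B13TermRep.actMajorant 𝒯 inc (factorMass 𝔠 N₀f bf m⋆ H) k X i` — ZERO off the localization relation
  (part 7's weight letter vanishes there), `‖coeff i‖·Π_m factorMass (poly i m) (lab i m)` on it (`e^{(Σ N₁)‖h‖} ≤ Π e^{N₁ H}`,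
  `(2π∕min mf)^{Σ d∕2} ≤ Π (2π∕m⋆)^{d∕2}` by `Real.rpow_le_rpow` + `Real.rpow_sum_of_pos`).
Hence `hmass` for the B13 step with core activities follows from ANY per-domain bound `actMajorant 𝒯 inc (factorMass …) k X i ≤ a k i X·e^{−κd(X)}` —
the (2.38)-KIND per-factor majorants with their decay and the (2.39)–(2.41) tuple combinatorics (the O1-d2 (iii) engine `UrsellTermBudget` ∕
`UrsellTermDecay` sums exactly `actMajorant`); those inequalities stay DISPLAYED.

STATUS (census, Edison rule).  Arithmetic∕bookkeeping; no estimate of [II] is proved or asserted.  NE5 NOT PROVED; 0/12 leaves on Bałaban's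
concrete objects; spine 0/9; rung (B)+1 finite T⁴; NOT infinite volume ∕ mass gap ∕ Clay.  0 sorry; axioms ⊆ {propext, Classical.choice, Quot.sound}.
-/

noncomputable section

open scoped BigOperators
open Set Metric MeasureTheory Finset WithLp

namespace Summit.QuantumFields.BalabanUV.T4Continuum.B13TermCoreMass

open Literature.MathematicalPhysics.QuantumFieldTheory.Balaban1983to89
open Literature.MathematicalPhysics.QuantumFieldTheory.Balaban1983to89.T4OutputRate (Carriers)
open Summit.QuantumFields.BalabanUV.T4Continuum.B13HistMeasurable (MeasPotFrame B13HistM)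
open Summit.QuantumFields.BalabanUV.T4Continuum.B13StepTermFamily (TermIndexing coeff)
open Summit.QuantumFields.BalabanUV.T4Continuum.B13TermRep (actMajorant actMajorant_of_rel actMajorant_of_not_rel)
open Summit.QuantumFields.BalabanUV.T4Continuum.B13TermParamGaussianBi (BiCore)
open Summit.QuantumFields.BalabanUV.T4Continuum.B13TermCoreFamily (factorCores termCore)
open Summit.QuantumFields.BalabanUV.T4Continuum.OutputRateOpGaussianParam (paramMass)

variable {C : Carriers} {P : MeasPotFrame C} {Op : Type*} {ι Pol J : Type*}
  (𝒯 : TermIndexing C ι Pol J) (inc : Pol → Pol → Prop) [DecidableRel inc]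
  {𝒴 : Pol → J → Type*} {dom : ∀ Z j, 𝒴 Z j → C.Dom} {PΛ : Pol → J → Type*} {V : Pol → J → Type*}
  [∀ Z j, MeasurableSpace (PΛ Z j)] [∀ Z j, NormedAddCommGroup (V Z j)] [∀ Z j, InnerProductSpace ℝ (V Z j)]
  [∀ Z j, MeasurableSpace (V Z j)] (𝔠 : ∀ Z j, BiCore P (dom Z j) Op (PΛ Z j) (V Z j))

/-! ## §1 The product data of a term core: total parameter mass and fluctuation dimension -/

section Data

/-- [folklore] The total mass of the term core's parameter measure is the product of the factors' (`Measure.pi_univ`). -/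
theorem lam_termCore_real_univ (k : ℕ) (i : ι) (X : C.Dom) :
    (termCore 𝒯 inc 𝔠 k i X).lam.real univ = ∏ m, (factorCores 𝒯 𝔠 i m).lam.real univ := by
  haveI : ∀ m, IsFiniteMeasure (factorCores 𝒯 𝔠 i m).lam := fun m => (factorCores 𝒯 𝔠 i m).finite
  rw [measureReal_def, B13TermCoreFamily.lam_termCore, Measure.pi_univ, ENNReal.toReal_prod]
  rfl

variable [∀ Z j, FiniteDimensional ℝ (V Z j)]

omit [∀ Z j, MeasurableSpace (V Z j)] in
/-- [folklore] The fluctuation space of a term core has dimension `Σ_m dim V (poly i m) (lab i m)` (`L²`-product of the factors'). -/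
theorem finrank_fluct_termCore (i : ι) :
    Module.finrank ℝ (PiLp 2 fun m : Fin (𝒯.len i + 1) => V (𝒯.poly i m) (𝒯.lab i m)) =
      ∑ m : Fin (𝒯.len i + 1), Module.finrank ℝ (V (𝒯.poly i m) (𝒯.lab i m)) := by
  rw [(WithLp.linearEquiv 2 ℝ (∀ m : Fin (𝒯.len i + 1), V (𝒯.poly i m) (𝒯.lab i m))).finrank_eq, Module.finrank_pi_fintype]

end Data

/-! ## §2 The factor mass letter -/

section Letter

/-- **THE FACTOR MASS LETTER** `A Z j := λ_{Zj}(univ)·wB_{Zj}·N₀f(Z,j)·e^{N₁,Zj·H + bf(Z,j)}·(2π∕m⋆)^{dim V_{Zj}∕2}` — the one-factor Gaussian majorant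
mass at history radius `H` and margin floor `m⋆` (the currency of `B13TermRep.actMajorant`). [folklore] -/
def factorMass (N₀f bf : Pol → J → ℝ) (mstar H : ℝ) (Z : Pol) (j : J) : ℝ :=
  (𝔠 Z j).lam.real univ * (𝔠 Z j).wB * N₀f Z j * Real.exp ((𝔠 Z j).N₁ * H + bf Z j) *
    (2 * Real.pi / mstar) ^ (Module.finrank ℝ (V Z j) / 2 : ℝ)

variable {𝔠}

/-- [folklore] The factor mass letter is nonnegative for nonnegative `wB`, `N₀f` and `0 < m⋆`. -/
theorem factorMass_nonneg {N₀f bf : Pol → J → ℝ} {mstar H : ℝ} (hwB : ∀ Z j, 0 ≤ (𝔠 Z j).wB) (hN₀ : ∀ Z j, 0 ≤ N₀f Z j)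
    (hm : 0 < mstar) (Z : Pol) (j : J) : 0 ≤ factorMass 𝔠 N₀f bf mstar H Z j := by
  unfold factorMass
  have h2 : 0 ≤ 2 * Real.pi / mstar := by positivity
  exact mul_nonneg (mul_nonneg (mul_nonneg (mul_nonneg measureReal_nonneg (hwB Z j)) (hN₀ Z j)) (Real.exp_nonneg _))
    (Real.rpow_nonneg h2 _)

end Letter

/-! ## §3 The per-domain mass of a term core is at most the combinatorial majorant of the factor masses -/

section Mass

variable {𝒯 inc 𝔠}
variable [∀ Z j, FiniteDimensional ℝ (V Z j)]

/-- **`paramMass ≤ actMajorant (factorMass)`** — the `hmass` currency of the R21 END for the term cores of part 7: with a uniform margin floor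
`0 < m⋆ ≤ mf`, nonnegative `wB`∕`N₀f` and a history radius `‖h‖ ≤ H`, the per-domain Gaussian majorant mass of the term `(k, i, X)` (data and
letters exactly as in `B13TermCoreFamily.termGaussianParamBi_term_of_factors`) is at most `𝟙[Rel k i X]·‖coeff i‖·Π_m factorMass (poly i m) (lab i m)`.
[folklore] -/
theorem paramMass_termCore_le_actMajorant {N₀f mf bf : Pol → J → ℝ} {mstar H : ℝ} (hm : 0 < mstar) (hmf : ∀ Z j, mstar ≤ mf Z j)
    (hwB : ∀ Z j, 0 ≤ (𝔠 Z j).wB) (hN₀ : ∀ Z j, 0 ≤ N₀f Z j) (k : ℕ) (i : ι) (X : C.Dom) {h : B13HistM P} (hh : ‖h‖ ≤ H) :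
    paramMass (fun _ i => PiLp 2 fun m : Fin (𝒯.len i + 1) => V (𝒯.poly i m) (𝒯.lab i m))
        (fun k i (_ : B13HistM P) X => (termCore 𝒯 inc 𝔠 k i X).lam)
        (fun k i (_ : B13HistM P) X =>
          if 𝒯.Rel k i X then Finset.univ.inf' Finset.univ_nonempty (fun m => mf (𝒯.poly i m) (𝒯.lab i m)) else 1)
        (fun k i (_ : B13HistM P) X => if 𝒯.Rel k i X then ∑ m, bf (𝒯.poly i m) (𝒯.lab i m) else 0)
        (fun k i (_ : B13HistM P) X => (termCore 𝒯 inc 𝔠 k i X).wB)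
        (fun k i (_ : B13HistM P) X => if 𝒯.Rel k i X then ∏ m, N₀f (𝒯.poly i m) (𝒯.lab i m) else 1)
        (fun k i h X => 1 * Real.exp ((termCore 𝒯 inc 𝔠 k i X).N₁ * ‖h‖)) k i h X ≤
      actMajorant 𝒯 inc (factorMass 𝔠 N₀f bf mstar H) k X i := by
  unfold paramMass
  by_cases hR : 𝒯.Rel k i X
  · rw [actMajorant_of_rel hR]
    simp only [if_pos hR, B13TermCoreFamily.wB_termCore, B13TermCoreFamily.N₁_termCore, lam_termCore_real_univ, finrank_fluct_termCore,
      one_mul]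
    -- abbreviations for the factor letters along the tuple
    set l : Fin (𝒯.len i + 1) → ℝ := fun m => (factorCores 𝒯 𝔠 i m).lam.real univ with hl
    set wb : Fin (𝒯.len i + 1) → ℝ := fun m => (factorCores 𝒯 𝔠 i m).wB with hwb
    set n0 : Fin (𝒯.len i + 1) → ℝ := fun m => N₀f (𝒯.poly i m) (𝒯.lab i m) with hn0
    set n1 : Fin (𝒯.len i + 1) → ℝ := fun m => (factorCores 𝒯 𝔠 i m).N₁ with hn1
    set bb : Fin (𝒯.len i + 1) → ℝ := fun m => bf (𝒯.poly i m) (𝒯.lab i m) with hbb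
    set dd : Fin (𝒯.len i + 1) → ℝ := fun m => (Module.finrank ℝ (V (𝒯.poly i m) (𝒯.lab i m)) / 2 : ℝ) with hdd
    set mmin : ℝ := Finset.univ.inf' Finset.univ_nonempty (fun m => mf (𝒯.poly i m) (𝒯.lab i m)) with hmmin
    have hmmin_ge : mstar ≤ mmin := (Finset.le_inf'_iff _ _).2 fun m _ => hmf _ _
    have hmmin_pos : 0 < mmin := hm.trans_le hmmin_ge
    -- nonnegativity of the factor groups
    have hl0 : 0 ≤ ∏ m, l m := Finset.prod_nonneg fun m _ => measureReal_nonneg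
    have hwb0 : 0 ≤ ∏ m, wb m := Finset.prod_nonneg fun m _ => hwB _ _
    have hn00 : 0 ≤ ∏ m, n0 m := Finset.prod_nonneg fun m _ => hN₀ _ _
    have hn10 : 0 ≤ ∑ m, n1 m := Finset.sum_nonneg fun m _ => (factorCores 𝒯 𝔠 i m).N₁_nonneg
    -- (1) the exponential group: `e^{(Σ N₁)‖h‖}·e^{Σ b} ≤ Π_m e^{N₁,m H + b_m}`
    have hE : Real.exp ((∑ m, n1 m) * ‖h‖) * Real.exp (∑ m, bb m) ≤ ∏ m, Real.exp (n1 m * H + bb m) := by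
      rw [← Real.exp_add, ← Real.exp_sum]
      refine Real.exp_le_exp.2 ?_
      rw [Finset.sum_add_distrib, ← Finset.sum_mul]
      nlinarith [mul_le_mul_of_nonneg_left hh hn10]
    -- (2) the Gaussian group: `(π∕(min mf∕2))^{(Σ d)∕2} ≤ Π_m (2π∕m⋆)^{d_m∕2}`
    have hG : (Real.pi / (mmin / 2)) ^ ((∑ m : Fin (𝒯.len i + 1), Module.finrank ℝ (V (𝒯.poly i m) (𝒯.lab i m)) : ℕ) / 2 : ℝ) ≤
        ∏ m, (2 * Real.pi / mstar) ^ dd m := by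
      have hbase : Real.pi / (mmin / 2) ≤ 2 * Real.pi / mstar := by
        rw [div_div_eq_mul_div, mul_comm]
        exact div_le_div_of_nonneg_left (by positivity) hm hmmin_ge
      have hexp : ((∑ m : Fin (𝒯.len i + 1), Module.finrank ℝ (V (𝒯.poly i m) (𝒯.lab i m)) : ℕ) / 2 : ℝ) = ∑ m, dd m := by
        rw [hdd, Nat.cast_sum, Finset.sum_div]
      rw [hexp, ← Real.rpow_sum_of_pos (by positivity : 0 < 2 * Real.pi / mstar)]
      exact Real.rpow_le_rpow (by positivity) hbase (Finset.sum_nonneg fun m _ => by rw [hdd]; positivity)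
    have hG0 : 0 ≤ (Real.pi / (mmin / 2)) ^ ((∑ m : Fin (𝒯.len i + 1), Module.finrank ℝ (V (𝒯.poly i m) (𝒯.lab i m)) : ℕ) / 2 : ℝ) :=
      Real.rpow_nonneg (by positivity) _
    -- assemble: both sides are `‖coeff‖·(Π l)(Π wB)(Π N₀)·(exponential group)·(Gaussian group)`
    have hRHS : ‖coeff 𝒯 inc i‖ * ∏ m, factorMass 𝔠 N₀f bf mstar H (𝒯.poly i m) (𝒯.lab i m) =
        ‖coeff 𝒯 inc i‖ * ((∏ m, l m) * (∏ m, wb m) * (∏ m, n0 m)) * (∏ m, Real.exp (n1 m * H + bb m)) *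
          ∏ m, (2 * Real.pi / mstar) ^ dd m := by
      simp only [factorMass, Finset.prod_mul_distrib, hl, hwb, hn0, hn1, hbb, hdd]
      ring
    rw [hRHS]
    have hLHS : (∏ m, l m) * (‖coeff 𝒯 inc i‖ * (∏ m, wb m) * (∏ m, n0 m) *
        (Real.exp ((∑ m, n1 m) * ‖h‖) * Real.exp (∑ m, bb m))) *
        (Real.pi / (mmin / 2)) ^ ((∑ m : Fin (𝒯.len i + 1), Module.finrank ℝ (V (𝒯.poly i m) (𝒯.lab i m)) : ℕ) / 2 : ℝ) =
        ‖coeff 𝒯 inc i‖ * ((∏ m, l m) * (∏ m, wb m) * (∏ m, n0 m)) *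
          (Real.exp ((∑ m, n1 m) * ‖h‖) * Real.exp (∑ m, bb m)) *
          (Real.pi / (mmin / 2)) ^ ((∑ m : Fin (𝒯.len i + 1), Module.finrank ℝ (V (𝒯.poly i m) (𝒯.lab i m)) : ℕ) / 2 : ℝ) := by
      ring
    have hK : 0 ≤ ‖coeff 𝒯 inc i‖ * ((∏ m, l m) * (∏ m, wb m) * (∏ m, n0 m)) :=
      mul_nonneg (norm_nonneg _) (mul_nonneg (mul_nonneg hl0 hwb0) hn00)
    calc (∏ m, l m) * (‖coeff 𝒯 inc i‖ * (∏ m, wb m) * (∏ m, n0 m) *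
          (Real.exp ((∑ m, n1 m) * ‖h‖) * Real.exp (∑ m, bb m))) *
          (Real.pi / (mmin / 2)) ^ ((∑ m : Fin (𝒯.len i + 1), Module.finrank ℝ (V (𝒯.poly i m) (𝒯.lab i m)) : ℕ) / 2 : ℝ)
        = ‖coeff 𝒯 inc i‖ * ((∏ m, l m) * (∏ m, wb m) * (∏ m, n0 m)) *
          (Real.exp ((∑ m, n1 m) * ‖h‖) * Real.exp (∑ m, bb m)) *
          (Real.pi / (mmin / 2)) ^ ((∑ m : Fin (𝒯.len i + 1), Module.finrank ℝ (V (𝒯.poly i m) (𝒯.lab i m)) : ℕ) / 2 : ℝ) := hLHS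
      _ ≤ ‖coeff 𝒯 inc i‖ * ((∏ m, l m) * (∏ m, wb m) * (∏ m, n0 m)) * (∏ m, Real.exp (n1 m * H + bb m)) *
          ∏ m, (2 * Real.pi / mstar) ^ dd m :=
        mul_le_mul (mul_le_mul_of_nonneg_left hE hK) hG hG0
          (mul_nonneg hK (Finset.prod_nonneg fun m _ => Real.exp_nonneg _))
  · rw [actMajorant_of_not_rel hR]
    simp only [if_neg hR, B13TermCoreFamily.wB_termCore, zero_mul, mul_zero]
    exact le_rfl

end Mass

end Summit.QuantumFields.BalabanUV.T4Continuum.B13TermCoreMass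

end
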